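import Literature.Geometry.Kaehler.ComplexTorusLefschetzGroupDimensionCriterion
import Literature.Geometry.Kaehler.ComplexTorusMumfordTateGroupMaximalTorus
import Literature.Geometry.Kaehler.ComplexTorusCMLefschetzGroupConnected
import Literature.Geometry.Kaehler.ComplexTorusCommutativeEndomorphismLefschetzGroupConnected
import Literature.NumberTheory.Automorphic.SpecialLinearZConnected
import HarnessLib

/-!
# Milne 1999: «`K` is a CM-field, and `S(A)` is a torus» — for an abelian variety of CM type (`End⁰(X)` commutative
# of dimension `2g`) the Lefschetz group `S(X)(ℂ) ≤ GL(V_ℂ)` IS A TORUS of the tree's linear-algebraic-groups library,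
# hence its own unique maximal torus: the table's «Rank» equals its «Dimension», `= g` for `X` simple
# (type IV, `d = 1`, `f = g`: «GL₁, `g` copies … Dimension `g²/(d²f) = g`, Rank `g/d = g`»)

Layer `Literature/Geometry/Kaehler`, namespace `Literature.Geometry.Kaehler.ComplexTorus`; lane `lit-hodgefound`
(Track 2 foundations library), Layer A4 (Lefschetz groups); prover seat `lit-hodgefound-p17`, generation 63,
self-proposed row g63-#7 — the item «`S(X)` as an `IsTorusSubgroup` of the tree's LAG library» recorded as NOT DONE
in skel-4's A4-92 `ComplexTorusCMLefschetzGroupConnected` (which proves `S(X)(ℂ) = P · 𝕋_π · P⁻¹ ≅ (ℂ^×)^g` and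
`Lf(X)(ℂ) = S(X)(ℂ)` in the lane's own `vanishingIdealC` language), and the first instance of the Summary table's
«RANK» column at torus level. Assembled BY NAME from: p02's `isZConnected_map_toGL_lefschetzIdentityC`
(`ComplexTorusLefschetzGroupReductive`: `Lf(X)(ℂ) ↦ GL(V_ℂ)` is Zariski-connected, the dictionary `K^{so} ↦` LAG),
`IsRiemannForm.lefschetzIdentityC_eq_lefschetzGroupC_of_endAlgRat_comm'` (`Lf = S` for commutative `End⁰(X)`,
`ComplexTorusCommutativeEndomorphismLefschetzGroupConnected`), p36's `coe_mem_span_of_mem_lefschetzGroupC` and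
`lefschetzGroupC_comm_of_comm_isReduced_le_endAlgRat` (`S(X)(ℂ) ⊆ T ⊗ ℂ`, commutative; `ComplexTorusLefschetzGroupCommutative`),
`isSemisimple_toLin'_of_mem_span_image` (`T ⊗ ℂ` consists of semisimple endomorphisms; `ComplexTorusHodgeGroupTorusIffCM`),
`IsTorusSubgroup.isMaximalTorusIn_iff_eq` ∕ `isMaximalTorusIn_self_iff` (`ComplexTorusMumfordTateGroupMaximalTorus`),
`IsZConnected.zdim_congr` and `IsSimple.zdim_lefschetzIdentityC_eq_finrank_of_isCMField_of_endAlgRat_comm`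
(`dim Lf(X) = g`, `ComplexTorusLefschetzGroupDimensionCriterion`). THEOREMS ONLY (no definition, no instance, no
notation, no named fact; D-0026, net debt 0).

## Sources, VERBATIM (held text `paper:doi-10-1215-s0012-7094-99-09620-5`, PDF page = printed page − 638)

* J. S. Milne, *Lefschetz classes on abelian varieties*, Duke Math. J. **96** (1999) 639–675. §3, p. 657 (p0019
  L30–L35): «If `A` is not a supersingular elliptic curve, then `K` is a CM-field, and `S(A)` is a torus. Every
  embedding `σ : K ↪ k^al` defines a character `ξ_σ` of `S(A)`, and the character group of `S(A)` is the quotient of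
  `⊕ ℤξ_σ` by the subgroup generated by the elements `ξ_σ + ξ_{ισ}`. […] the weights of `S(A)` in `H¹(A) ⊗ k^al` are
  precisely the characters `ξ_σ`, `σ ∈ Hom(K, k^al)`, and each has the same multiplicity.» (stated there for `A` over
  `𝔽`, with `K` the centre of `End⁰(A)` acting on `V(A)` with `dim_K V = 1` — the same linear algebra as a complex
  abelian variety of CM type); §2 Summary, p. 652 (p0014): «Type IV ∣ Group `GL_{g/(df)}` ∣ Semisimple No ∣ Connected
  Yes ∣ Dimension `g²/(d²f)` ∣ Rank `g/d` […] The group `S(A)_{/k^al}` is isomorphic to `f` copies of the group listed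
  […] the remaining columns give its dimension and rank (over `k^al`).» (here `d = 1`, `f = g`).
* P. Deligne, *Hodge cycles on abelian varieties* (LNM 900, 1982), I §5, proof of Prop. 5.1: «By assumption `G` is a
  torus […] étale commutative algebras of rank `dim H₁(A, ℚ)`».
* T. A. Springer, *Linear Algebraic Groups*, 2nd ed. (1998), 3.2.1 (torus: connected diagonalizable), 6.3.5–6.3.6 and
  §6.4 (maximal tori), 1.8.1 (dimension).
* H. Lange, *Abelian Varieties over the Complex Numbers* (2023), §7.2.3 Prop. 7.2.6 and §7.2.4 Exercise (4) (`Lf(X)`);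
  B. B. Gordon, *A survey of the Hodge conjecture for abelian varieties* (1999), Prop. 2.12 (the `Hg` analogue).

## What is proved (CONCRETE torus level `X = E/Φ(ℤ^ι)`, `S(X)(ℂ) = lefschetzGroupC Φ G ≤ SL(V_ℂ) ↦ GL(V_ℂ)`)

* §1 `isSemisimpleElt_toGL_of_mem_lefschetzGroupC` (every complex torus, any `G`: a commutative reduced
  `T ≤ End⁰(X)` of dimension `2g` makes every element of `S(X)(ℂ) ⊆ T ⊗ ℂ` semisimple),
  `isMulCommutative_map_toGL_lefschetzGroupC`, `IsRiemannForm.isZConnected_map_toGL_lefschetzGroupC_of_endAlgRat_comm`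
  (polarised, `End⁰(X)` commutative: `S(X)(ℂ)` is Zariski-connected in `GL(V_ℂ)`), and the headline
  **`IsRiemannForm.isTorusSubgroup_map_toGL_lefschetzGroupC_of_endAlgRat_comm`** («`S(A)` is a torus»).
* §2 «Rank»: **`IsRiemannForm.isMaximalTorusIn_map_toGL_lefschetzGroupC_iff_eq_of_endAlgRat_comm`** (the maximal tori of
  `S(X)(ℂ)` are exactly `S(X)(ℂ)` itself), `IsRiemannForm.isMaximalTorusIn_map_toGL_lefschetzGroupC_self_of_endAlgRat_comm`,
  `IsRiemannForm.zdim_eq_zdim_of_isMaximalTorusIn_map_toGL_lefschetzGroupC_of_endAlgRat_comm` (rank = dimension),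
  and for `X` SIMPLE with CM centre **`IsSimple.zdim_eq_finrank_of_isMaximalTorusIn_map_toGL_lefschetzGroupC`**
  (every maximal torus of `S(X)(ℂ)` has dimension `g`: «Rank `g/d`», `d = 1`).

NOT here: the «Rank» column for the other Albert types (maximal tori of `Sp`, `O`, `GL_n` powers).

## References

* [Milne1999LefschetzClasses] J. S. Milne, *Lefschetz classes on abelian varieties*, Duke Math. J. 96 (1999)
  639–675: §3 p. 657, §2 Summary table (p. 652).
* [Deligne1982HodgeCycles] P. Deligne, *Hodge cycles on abelian varieties*, LNM 900 (1982), I Prop. 5.1 (proof).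
* [Springer1998] T. A. Springer, *Linear Algebraic Groups*, 2nd ed., Birkhäuser (1998), 1.8.1, 3.2.1, 6.3.5–6.3.6, §6.4.
* [Lange2023AbelianVarietiesComplex] H. Lange, *Abelian Varieties over the Complex Numbers*, Springer (2023),
  Prop. 7.2.6, §7.2.4 Exercise (4).
* [Gordon1999HodgeAVSurvey] B. B. Gordon, *A survey of the Hodge conjecture for abelian varieties* (1999), Prop. 2.12.
-/

noncomputable section

open Module Matrix NumberField
open Literature.NumberTheory.Automorphic

namespace Literature.Geometry.Kaehler

namespace ComplexTorus

/-! ## §1 `S(X)(ℂ)` is a torus of `GL(V_ℂ)` for an abelian variety of CM type -/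

section Torus

variable {ι : Type*} [Fintype ι] [DecidableEq ι] {E : Type*} [NormedAddCommGroup E] [NormedSpace ℂ E]
  {Φ : (ι → ℝ) ≃L[ℝ] E} {G : Matrix ι ι ℚ}

/-- **Every element of `S(X)(ℂ)` is semisimple** when `End⁰(X)` contains a commutative reduced `ℚ`-subalgebra `T` of
dimension `2g` (every complex torus, any `G`): `S(X)(ℂ) ⊆ T ⊗ ℂ` (the tree's `coe_mem_span_of_mem_lefschetzGroupC`),
an étale algebra of simultaneously diagonalisable matrices. [cite: Deligne1982HodgeCycles, I Prop. 5.1 (proof: «`G` is a torus … étale commutative algebras of rank `dim H₁(A, ℚ)`»)]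
[cite: Springer1998, 3.2.1 and 2.4.2] -/
theorem isSemisimpleElt_toGL_of_mem_lefschetzGroupC (T : Subalgebra ℚ (Matrix ι ι ℚ)) [IsReduced T]
    (hTE : T ≤ endAlgRat Φ) (hcomm : ∀ a ∈ T, ∀ b ∈ T, a * b = b * a) (hdim : finrank ℚ T = Fintype.card ι)
    {M : SpecialLinearGroup ι ℂ} (hM : M ∈ lefschetzGroupC Φ G) :
    IsSemisimpleElt (Matrix.SpecialLinearGroup.toGL M) :=
  isSemisimple_toLin'_of_mem_span_image T hcomm (coe_mem_span_of_mem_lefschetzGroupC T hTE hcomm hdim hM)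

variable (G) in
/-- **`S(X)(ℂ) ↦ GL(V_ℂ)` is commutative** under the same hypothesis (the tree's
`lefschetzGroupC_comm_of_comm_isReduced_le_endAlgRat` read on the image in `GL`). [cite: Lange2023AbelianVarietiesComplex, §7.2.3 Prop. 7.2.6 ((ii) ⇒ (i))]
[cite: Milne1999LefschetzClasses, §3 p. 657 («`S(A)` is a torus»)] -/
theorem isMulCommutative_map_toGL_lefschetzGroupC (T : Subalgebra ℚ (Matrix ι ι ℚ)) [IsReduced T]
    (hTE : T ≤ endAlgRat Φ) (hcomm : ∀ a ∈ T, ∀ b ∈ T, a * b = b * a) (hdim : finrank ℚ T = Fintype.card ι) :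
    IsMulCommutative ↥((lefschetzGroupC Φ G).map Matrix.SpecialLinearGroup.toGL) := by
  refine ⟨⟨fun x y ↦ Subtype.ext ?_⟩⟩
  obtain ⟨M, hM, hx⟩ := x.2
  obtain ⟨N, hN, hy⟩ := y.2
  rw [Subgroup.coe_mul, Subgroup.coe_mul, ← hx, ← hy, ← map_mul, ← map_mul,
    lefschetzGroupC_comm_of_comm_isReduced_le_endAlgRat T hTE hcomm hdim hM hN]

variable {η : E [⋀^Fin 2]→L[ℝ] ℝ}

/-- **`S(X)(ℂ) ↦ GL(V_ℂ)` is Zariski-connected for a polarised abelian variety with commutative `End⁰(X)`**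
(`S(X)(ℂ) = Lf(X)(ℂ)`, «Connected: Yes», and `Lf(X)(ℂ)` is Zariski-connected in the LAG library).
[cite: Milne1999LefschetzClasses, §2 Summary table (type IV: «Connected: Yes»)] [cite: Springer1998, 2.2.1] -/
theorem IsRiemannForm.isZConnected_map_toGL_lefschetzGroupC_of_endAlgRat_comm (hη : IsRiemannForm Φ η)
    (hG : G.map (Rat.cast : ℚ → ℝ) = latticeGram Φ η) (hcomm : ∀ a ∈ endAlgRat Φ, ∀ b ∈ endAlgRat Φ, a * b = b * a) :
    IsZConnected ((lefschetzGroupC Φ G).map Matrix.SpecialLinearGroup.toGL) := by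
  rw [← hη.lefschetzIdentityC_eq_lefschetzGroupC_of_endAlgRat_comm' hG hcomm]
  exact (isZConnected_map_toGL_lefschetzIdentityC Φ G).1

/-- **«`K` IS A CM-FIELD, AND `S(A)` IS A TORUS»: for a polarised abelian variety of CM type — `End⁰(X)` commutative
of dimension `2g` (a simple one with `End⁰(X) = K` a CM field of degree `2g`, or a product of pairwise non-isogenous
such) — the Lefschetz group `S(X)(ℂ) ↦ GL(V_ℂ)` is a TORUS of the tree's linear-algebraic-groups library**
(Zariski-connected, commutative, consisting of semisimple elements; Springer 3.2.1). `End⁰(X)` is semisimple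
(Poincaré) and commutative, hence reduced. [cite: Milne1999LefschetzClasses, §3 p. 657 and §2 Summary table (type IV, `d = 1`, `f = g`: «GL₁ … `f` copies»)]
[cite: Deligne1982HodgeCycles, I Prop. 5.1 (proof)] [cite: Springer1998, 3.2.1] -/
theorem IsRiemannForm.isTorusSubgroup_map_toGL_lefschetzGroupC_of_endAlgRat_comm (hη : IsRiemannForm Φ η)
    (hG : G.map (Rat.cast : ℚ → ℝ) = latticeGram Φ η) (hcomm : ∀ a ∈ endAlgRat Φ, ∀ b ∈ endAlgRat Φ, a * b = b * a)
    (hdim : finrank ℚ (endAlgRat Φ) = Fintype.card ι) :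
    IsTorusSubgroup ((lefschetzGroupC Φ G).map Matrix.SpecialLinearGroup.toGL) := by
  haveI := hη.isSemisimpleRing_endAlgRat
  letI : CommRing (endAlgRat Φ) :=
    { (inferInstance : Ring (endAlgRat Φ)) with mul_comm := fun a b ↦ Subtype.ext (hcomm a.1 a.2 b.1 b.2) }
  haveI : IsReduced (endAlgRat Φ) := inferInstance
  refine ⟨hη.isZConnected_map_toGL_lefschetzGroupC_of_endAlgRat_comm hG hcomm,
    isMulCommutative_map_toGL_lefschetzGroupC G (endAlgRat Φ) le_rfl hcomm hdim, ?_⟩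
  rintro _ ⟨M, hM, rfl⟩
  exact isSemisimpleElt_toGL_of_mem_lefschetzGroupC (endAlgRat Φ) le_rfl hcomm hdim hM

/-- The same for Lange's `Lf(X)(ℂ)` (`= S(X)(ℂ)` here): a torus. [cite: Milne1999LefschetzClasses, §3 p. 657 and §2 Summary table (type IV)]
[cite: Lange2023AbelianVarietiesComplex, §7.2.4 Exercise (4)] -/
theorem IsRiemannForm.isTorusSubgroup_map_toGL_lefschetzIdentityC_of_endAlgRat_comm (hη : IsRiemannForm Φ η)
    (hG : G.map (Rat.cast : ℚ → ℝ) = latticeGram Φ η) (hcomm : ∀ a ∈ endAlgRat Φ, ∀ b ∈ endAlgRat Φ, a * b = b * a)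
    (hdim : finrank ℚ (endAlgRat Φ) = Fintype.card ι) :
    IsTorusSubgroup ((lefschetzIdentityC Φ G).map Matrix.SpecialLinearGroup.toGL) := by
  rw [hη.lefschetzIdentityC_eq_lefschetzGroupC_of_endAlgRat_comm' hG hcomm]
  exact hη.isTorusSubgroup_map_toGL_lefschetzGroupC_of_endAlgRat_comm hG hcomm hdim

end Torus

/-! ## §2 The «Rank» column for CM type: the maximal tori of `S(X)(ℂ)` are `S(X)(ℂ)` itself; rank `=` dimension `= g` -/

section Rank

variable {ι : Type*} [Fintype ι] [DecidableEq ι] {E : Type*} [NormedAddCommGroup E] [NormedSpace ℂ E]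
  {Φ : (ι → ℝ) ≃L[ℝ] E} {η : E [⋀^Fin 2]→L[ℝ] ℝ} {G : Matrix ι ι ℚ}

/-- **THE MAXIMAL TORI OF `S(X)(ℂ)`, CM TYPE: `T` is a maximal torus of `S(X)(ℂ) ↦ GL(V_ℂ)` iff `T = S(X)(ℂ)`** (a torus
is its own unique maximal torus). [cite: Milne1999LefschetzClasses, §3 p. 657 («`S(A)` is a torus») and §2 Summary table (column «Rank»)]
[cite: Springer1998, §6.4 (maximal tori) and 3.2.1] -/
theorem IsRiemannForm.isMaximalTorusIn_map_toGL_lefschetzGroupC_iff_eq_of_endAlgRat_comm (hη : IsRiemannForm Φ η)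
    (hG : G.map (Rat.cast : ℚ → ℝ) = latticeGram Φ η) (hcomm : ∀ a ∈ endAlgRat Φ, ∀ b ∈ endAlgRat Φ, a * b = b * a)
    (hdim : finrank ℚ (endAlgRat Φ) = Fintype.card ι) {T : Subgroup (GL ι ℂ)} :
    IsMaximalTorusIn T ((lefschetzGroupC Φ G).map Matrix.SpecialLinearGroup.toGL) ↔
      T = (lefschetzGroupC Φ G).map Matrix.SpecialLinearGroup.toGL :=
  (hη.isTorusSubgroup_map_toGL_lefschetzGroupC_of_endAlgRat_comm hG hcomm hdim).isMaximalTorusIn_iff_eq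

/-- **`S(X)(ℂ)` is a maximal torus of itself** (CM type). [cite: Milne1999LefschetzClasses, §3 p. 657 and §2 Summary table (column «Rank»)]
[cite: Springer1998, §6.4] -/
theorem IsRiemannForm.isMaximalTorusIn_map_toGL_lefschetzGroupC_self_of_endAlgRat_comm (hη : IsRiemannForm Φ η)
    (hG : G.map (Rat.cast : ℚ → ℝ) = latticeGram Φ η) (hcomm : ∀ a ∈ endAlgRat Φ, ∀ b ∈ endAlgRat Φ, a * b = b * a)
    (hdim : finrank ℚ (endAlgRat Φ) = Fintype.card ι) :
    IsMaximalTorusIn ((lefschetzGroupC Φ G).map Matrix.SpecialLinearGroup.toGL)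
      ((lefschetzGroupC Φ G).map Matrix.SpecialLinearGroup.toGL) :=
  isMaximalTorusIn_self_iff.2 (hη.isTorusSubgroup_map_toGL_lefschetzGroupC_of_endAlgRat_comm hG hcomm hdim)

/-- **RANK `=` DIMENSION for CM type**: every maximal torus of `S(X)(ℂ)` has the dimension of `Lf(X)(ℂ) = S(X)(ℂ)` (the
tree's `zdim`). [cite: Milne1999LefschetzClasses, §2 Summary table (type IV, `d = 1`: Dimension `g²/(d²f)` = Rank `g/d`)]
[cite: Springer1998, 1.8.1 and §6.4] -/
theorem IsRiemannForm.zdim_eq_zdim_of_isMaximalTorusIn_map_toGL_lefschetzGroupC_of_endAlgRat_comm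
    (hη : IsRiemannForm Φ η) (hG : G.map (Rat.cast : ℚ → ℝ) = latticeGram Φ η)
    (hcomm : ∀ a ∈ endAlgRat Φ, ∀ b ∈ endAlgRat Φ, a * b = b * a) (hdim : finrank ℚ (endAlgRat Φ) = Fintype.card ι)
    {T : Subgroup (GL ι ℂ)} (hT : IsMaximalTorusIn T ((lefschetzGroupC Φ G).map Matrix.SpecialLinearGroup.toGL)) :
    hT.2.1.1.zdim = (isZConnected_map_toGL_lefschetzIdentityC Φ G).1.zdim :=
  hT.2.1.1.zdim_congr _ (((hη.isMaximalTorusIn_map_toGL_lefschetzGroupC_iff_eq_of_endAlgRat_comm hG hcomm hdim).1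
    hT).trans (congrArg (Subgroup.map Matrix.SpecialLinearGroup.toGL)
      (hη.lefschetzIdentityC_eq_lefschetzGroupC_of_endAlgRat_comm' hG hcomm).symm))

end Rank

section Simple

variable {κ : Type} [Fintype κ] [DecidableEq κ] [Nonempty κ] {E : Type} [NormedAddCommGroup E] [NormedSpace ℂ E]
  [FiniteDimensional ℂ E] {Ψ : (κ → ℝ) ≃L[ℝ] E} {η : E [⋀^Fin 2]→L[ℝ] ℝ} {G : Matrix κ κ ℚ}

/-- **«RANK `g/d`» WITH `d = 1`, `f = g`: every maximal torus of `S(X)(ℂ)` has dimension `g`** for a SIMPLE polarised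
abelian variety of CM type (`End⁰(X)` commutative of dimension `2g`, its centre a CM field): `S(X)(ℂ)` is its own
maximal torus and `dim S(X) = dim Lf(X) = g` (the tree's `IsSimple.zdim_lefschetzIdentityC_eq_finrank_of_isCMField_of_endAlgRat_comm`).
[cite: Milne1999LefschetzClasses, §2 Summary table p. 652 (type IV: Dimension `g²/(d²f)`, Rank `g/d`; «`f` copies») and §3 p. 657]
[cite: Springer1998, 1.8.1, 3.2.1, §6.4] -/
theorem IsSimple.zdim_eq_finrank_of_isMaximalTorusIn_map_toGL_lefschetzGroupC (hX : IsSimple Ψ)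
    (hη : IsRiemannForm Ψ η) (hG : G.map (Rat.cast : ℚ → ℝ) = latticeGram Ψ η) [IsCMField (centerField Ψ hX)]
    (hcomm : ∀ a ∈ endAlgRat Ψ, ∀ b ∈ endAlgRat Ψ, a * b = b * a) (hdim : finrank ℚ (endAlgRat Ψ) = Fintype.card κ)
    {T : Subgroup (GL κ ℂ)} (hT : IsMaximalTorusIn T ((lefschetzGroupC Ψ G).map Matrix.SpecialLinearGroup.toGL)) :
    hT.2.1.1.zdim = finrank ℂ E := by
  rw [hη.zdim_eq_zdim_of_isMaximalTorusIn_map_toGL_lefschetzGroupC_of_endAlgRat_comm hG hcomm hdim hT]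
  exact hX.zdim_lefschetzIdentityC_eq_finrank_of_isCMField_of_endAlgRat_comm hη hG hcomm hdim

/-- **`S(X)(ℂ)` ITSELF: a maximal torus of dimension `g`** (same setting). [cite: Milne1999LefschetzClasses, §2 Summary table p. 652 (type IV, `d = 1`) and §3 p. 657] -/
theorem IsSimple.isMaximalTorusIn_and_zdim_map_toGL_lefschetzGroupC (hX : IsSimple Ψ) (hη : IsRiemannForm Ψ η)
    (hG : G.map (Rat.cast : ℚ → ℝ) = latticeGram Ψ η) [IsCMField (centerField Ψ hX)]
    (hcomm : ∀ a ∈ endAlgRat Ψ, ∀ b ∈ endAlgRat Ψ, a * b = b * a) (hdim : finrank ℚ (endAlgRat Ψ) = Fintype.card κ) :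
    IsMaximalTorusIn ((lefschetzGroupC Ψ G).map Matrix.SpecialLinearGroup.toGL)
        ((lefschetzGroupC Ψ G).map Matrix.SpecialLinearGroup.toGL) ∧
      (hη.isZConnected_map_toGL_lefschetzGroupC_of_endAlgRat_comm hG hcomm).zdim = finrank ℂ E :=
  ⟨hη.isMaximalTorusIn_map_toGL_lefschetzGroupC_self_of_endAlgRat_comm hG hcomm hdim,
    hX.zdim_eq_finrank_of_isMaximalTorusIn_map_toGL_lefschetzGroupC hη hG hcomm hdim
      (hη.isMaximalTorusIn_map_toGL_lefschetzGroupC_self_of_endAlgRat_comm hG hcomm hdim)⟩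

end Simple

end ComplexTorus

end Literature.Geometry.Kaehler
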